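import Summits.BirchSwinnertonDyer.BirchSwinnertonDyer.Theorems.ClassRecordThreeEulerHalvesAtThreeCartanSupplyNormOneConj
import HarnessLib

/-!
# SUPPLY, the NORM-ONE count `Σ_g χ_W(g)² = |GL₂(𝔽_q)|`, part 2: the split torus

Helper file `--supports stmt-BirchSwinnertonDyer-19109 --as helper` (seat `bsd-idea-10` g13; crux `EulerHalvesAtThree` ∕ child 23422 line `cartan` v11,
stub SUPPLY; toward the hypothesis `CubicNewvectorCharNormOne` of `cartanTorusLatticeSupply_of_virtual`). Continues part 1 (conjugacy by
`(tr, det)`, fibre formula, double count). THIS FILE (all PROVED, `q` any prime):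
* §6 diagonal elements: rational eigenvalue, scalar iff equal entries, `Δ(diag u) = (u₀ − u₁)²`; the TYPE of a non-scalar split-torus element
  (`splitTorus_types`: rational eigenvalue and `Δ ≠ 0`); `#{g scalar} = q − 1` (`card_scalar`);
* §7 `#{x ∈ T_s : x ~ g}`: `0` unless `g` is scalar or SPLIT REGULAR (rational eigenvalue, `Δ ≠ 0`), and exactly `2` (the two orderings of the
  eigenvalues, `card_splitTorus_conj_of_split`); the centraliser of a split regular element has `(q − 1)²` elements (`card_centralizer_of_split`);
* §8 `#{y : y⁻¹gy ∈ T_s}` pointwise (`|G|` ∕ `2(q − 1)²` ∕ `0`), the SPLIT-TORUS IDENTITY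
  `|G|·Σ_{t ∈ T_s} F(t) = |G|·Σ_{g scalar} F(g) + 2(q − 1)²·Σ_{g split regular} F(g)` for every class function `F` (`splitTorus_identity`),
  and the count `2(q − 1)²·#{split regular} = |G|·((q − 1)² − (q − 1))` (`count_split`).
HONEST FRAMING: finite group ∕ finite-field bookkeeping only; NORM ONE itself is part 4; nothing about NUM, crux 23422 ∕ 19109 or any summit statement
is proved by this seat; BSD is proved for no curve. [folklore]
-/

set_option linter.dupNamespace false
set_option autoImplicit false

noncomputable section

namespace Summit.BirchSwinnertonDyer.BirchSwinnertonDyer.Theorems.CartanSupply.NormOne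

open Summit.BirchSwinnertonDyer.BirchSwinnertonDyer.Theorems.CartanDegree
open Summit.BirchSwinnertonDyer.BirchSwinnertonDyer.Theorems.CartanTorusCubeCut
open scoped Classical

variable {q : ℕ} [Fact q.Prime]

/-! ## §6 Diagonal elements -/

/-- PROVED: a diagonal element has a rational eigenvalue. [folklore] -/
theorem hasRatEigenvalue_diagGL (u : Fin 2 → (ZMod q)ˣ) : HasRatEigenvalue ((diagGL u : G q) : Mat q) := by
  refine ⟨(u 0 : ZMod q), ?_⟩
  rw [PS.diagGL_coe', Matrix.trace_fin_two, Matrix.det_fin_two]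
  simp
  ring

/-- PROVED: a diagonal element is scalar iff its two entries agree. [folklore] -/
theorem isScalarMat_diagGL_iff (u : Fin 2 → (ZMod q)ˣ) : IsScalarMat ((diagGL u : G q) : Mat q) ↔ u 0 = u 1 := by
  rw [PS.diagGL_coe']
  simp [IsScalarMat, Units.val_inj]

/-- PROVED: the discriminant of a diagonal element is `(u₀ − u₁)²`. [folklore] -/
theorem discr_diagGL (u : Fin 2 → (ZMod q)ˣ) :
    ((diagGL u : G q) : Mat q).trace ^ 2 - 4 * ((diagGL u : G q) : Mat q).det = ((u 0 : ZMod q) - (u 1 : ZMod q)) ^ 2 := by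
  rw [PS.diagGL_coe', Matrix.trace_fin_two, Matrix.det_fin_two]
  simp
  ring

/-- PROVED: `diagGL u ∈ T_s`. [folklore] -/
theorem diagGL_mem_splitTorus (u : Fin 2 → (ZMod q)ˣ) : diagGL u ∈ splitTorus q := by
  rw [splitTorus_eq_image]
  exact Finset.mem_image_of_mem _ (Finset.mem_univ _)

/-- PROVED: a non-scalar element of the split torus is SPLIT REGULAR: rational eigenvalue and `Δ ≠ 0`. [folklore] -/
theorem splitTorus_types {x : G q} (hx : x ∈ splitTorus q) (hns : ¬ IsScalarMat (x : Mat q)) :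
    HasRatEigenvalue (x : Mat q) ∧ (x : Mat q).trace ^ 2 - 4 * (x : Mat q).det ≠ 0 := by
  rw [splitTorus_eq_image] at hx
  obtain ⟨u, _, rfl⟩ := Finset.mem_image.1 hx
  refine ⟨hasRatEigenvalue_diagGL u, ?_⟩
  rw [discr_diagGL]
  exact pow_ne_zero 2 (sub_ne_zero.2 fun h => hns ((isScalarMat_diagGL_iff u).2 (Units.ext h)))

/-- PROVED: a scalar element lies in the split torus. [folklore] -/
theorem mem_splitTorus_of_isScalar {g : G q} (hs : IsScalarMat (g : Mat q)) : g ∈ splitTorus q := by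
  simp only [splitTorus, Finset.mem_filter, Finset.mem_univ, true_and]
  exact ⟨hs.1, hs.2.1⟩

/-- PROVED: the scalars of `GL₂(𝔽_q)` number `q − 1` (tree `card_scalar_splitTorus`). [folklore] -/
theorem card_scalar : (Finset.univ.filter fun g : G q => IsScalarMat (g : Mat q)).card = q - 1 := by
  rw [← card_scalar_splitTorus]
  congr 1
  ext g
  simp only [Finset.mem_filter, Finset.mem_univ, true_and]
  exact ⟨fun h => ⟨mem_splitTorus_of_isScalar h, h⟩, fun h => h.2⟩

/-! ## §7 Conjugates inside the split torus -/

/-- PROVED: a non-scalar element that is NOT split regular has no conjugate in `T_s`. [folklore] -/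
theorem card_splitTorus_conj_of_not (g : G q) (hg : ¬ IsScalarMat (g : Mat q))
    (h : ¬ (HasRatEigenvalue (g : Mat q) ∧ (g : Mat q).trace ^ 2 - 4 * (g : Mat q).det ≠ 0)) :
    ((splitTorus q).filter fun x => ∃ y : G q, y⁻¹ * g * y = x).card = 0 := by
  rw [Finset.card_eq_zero, Finset.filter_eq_empty_iff]
  rintro x hx ⟨y, rfl⟩
  have hns : ¬ IsScalarMat ((y⁻¹ * g * y : G q) : Mat q) := fun hs => hg ((isScalarMat_conj g y).1 hs)
  obtain ⟨hr, hΔ⟩ := splitTorus_types hx hns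
  exact h ⟨(hasRatEigenvalue_conj g y).1 hr, by rwa [discr_conj] at hΔ⟩

/-- PROVED — **TWO CONJUGATES IN `T_s`**: a split regular `g` (rational eigenvalue `l`, `Δ ≠ 0`) has exactly the two conjugates
`diag(l, m), diag(m, l)` in the split torus (`m = tr g − l`). [folklore] -/
theorem card_splitTorus_conj_of_split (g : G q) (hr : HasRatEigenvalue (g : Mat q))
    (hΔ : (g : Mat q).trace ^ 2 - 4 * (g : Mat q).det ≠ 0) :
    ((splitTorus q).filter fun x => ∃ y : G q, y⁻¹ * g * y = x).card = 2 := by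
  obtain ⟨l, hl⟩ := hr
  have hg : ¬ IsScalarMat (g : Mat q) := fun hs => hΔ (PS.discr_eq_zero_of_isScalar hs)
  have hdet : (g : Mat q).det ≠ 0 := by
    have hu : IsUnit (g : Mat q).det := by rw [← Matrix.isUnit_iff_isUnit_det]; exact Units.isUnit g
    exact hu.ne_zero
  have hlm : l ≠ (g : Mat q).trace - l := by
    intro e
    apply hΔ
    linear_combination (-4 : ZMod q) * hl + (2 * l - (g : Mat q).trace) * e
  have hl0 : l ≠ 0 := by
    rintro rfl
    apply hdet
    linear_combination hl
  have hm0 : (g : Mat q).trace - l ≠ 0 := by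
    intro e
    apply hdet
    linear_combination hl + l * e
  -- the two diagonal conjugates
  let ul : (ZMod q)ˣ := Units.mk0 l hl0
  let um : (ZMod q)ˣ := Units.mk0 ((g : Mat q).trace - l) hm0
  have hne : ul ≠ um := fun e => hlm (by simpa [ul, um] using congrArg (fun u : (ZMod q)ˣ => (u : ZMod q)) e)
  have hset : ((splitTorus q).filter fun x => ∃ y : G q, y⁻¹ * g * y = x) = {diagGL ![ul, um], diagGL ![um, ul]} := by
    ext x
    rw [Finset.mem_filter, conj_iff g x hg, Finset.mem_insert, Finset.mem_singleton]
    constructor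
    · rintro ⟨hx, hns, ht, hd⟩
      rw [splitTorus_eq_image] at hx
      obtain ⟨u, _, rfl⟩ := Finset.mem_image.1 hx
      have hu01 : u 0 ≠ u 1 := fun e => hns ((isScalarMat_diagGL_iff u).2 e)
      rw [PS.diagGL_coe', Matrix.trace_fin_two] at ht
      rw [PS.diagGL_coe', Matrix.det_fin_two] at hd
      simp at ht hd
      -- `u 0` is a root of `x² − t x + d = (x − l)(x − m)`
      have key : ((u 0 : ZMod q) - l) * ((u 0 : ZMod q) - ((g : Mat q).trace - l)) = 0 := by
        linear_combination (u 0 : ZMod q) * ht - hd - hl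
      rcases mul_eq_zero.1 key with h0 | h0
      · left
        have h0' : (u 0 : ZMod q) = l := sub_eq_zero.1 h0
        have h1' : (u 1 : ZMod q) = (g : Mat q).trace - l := by linear_combination ht - h0'
        congr 1
        funext i
        fin_cases i
        · exact Units.ext (by simpa [ul] using h0')
        · exact Units.ext (by simpa [um] using h1')
      · right
        have h0' : (u 0 : ZMod q) = (g : Mat q).trace - l := sub_eq_zero.1 h0
        have h1' : (u 1 : ZMod q) = l := by linear_combination ht - h0'
        congr 1
        funext i
        fin_cases i
        · exact Units.ext (by simpa [um] using h0')
        · exact Units.ext (by simpa [ul] using h1')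
    · rintro (rfl | rfl)
      · refine ⟨diagGL_mem_splitTorus _, fun hs => hne ((isScalarMat_diagGL_iff _).1 hs), ?_, ?_⟩
        · rw [PS.diagGL_coe', Matrix.trace_fin_two]; simp [ul, um]
        · rw [PS.diagGL_coe', Matrix.det_fin_two]; simp [ul, um]; linear_combination -hl
      · refine ⟨diagGL_mem_splitTorus _, fun hs => hne.symm ((isScalarMat_diagGL_iff _).1 hs), ?_, ?_⟩
        · rw [PS.diagGL_coe', Matrix.trace_fin_two]; simp [ul, um]
        · rw [PS.diagGL_coe', Matrix.det_fin_two]; simp [ul, um]; linear_combination -hl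
  rw [hset, Finset.card_insert_of_notMem, Finset.card_singleton]
  rw [Finset.mem_singleton]
  intro e
  have := congrFun (diagGL_injective e) 0
  simp at this
  exact hne this

/-- PROVED: the centraliser of a split regular element has `(q − 1)²` elements (it is conjugate to a regular diagonal one). [folklore] -/
theorem card_centralizer_of_split (g : G q) (hr : HasRatEigenvalue (g : Mat q))
    (hΔ : (g : Mat q).trace ^ 2 - 4 * (g : Mat q).det ≠ 0) :
    (Finset.univ.filter fun y : G q => y⁻¹ * g * y = g).card = (q - 1) ^ 2 := by
  have hg : ¬ IsScalarMat (g : Mat q) := fun hs => hΔ (PS.discr_eq_zero_of_isScalar hs)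
  have h2 := card_splitTorus_conj_of_split g hr hΔ
  obtain ⟨x, hx⟩ : ((splitTorus q).filter fun x => ∃ y : G q, y⁻¹ * g * y = x).Nonempty := by
    rw [← Finset.card_pos, h2]; norm_num
  rw [Finset.mem_filter] at hx
  obtain ⟨hxT, z, hz⟩ := hx
  rw [card_centralizer_conj g x z hz]
  rw [splitTorus_eq_image] at hxT
  obtain ⟨u, _, rfl⟩ := Finset.mem_image.1 hxT
  have hu : u 0 ≠ u 1 := by
    intro e
    have hs : IsScalarMat ((diagGL u : G q) : Mat q) := (isScalarMat_diagGL_iff u).2 e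
    rw [← hz] at hs
    exact hg ((isScalarMat_conj g z).1 hs)
  exact card_centralizer_diag u hu

/-! ## §8 `#{y : y⁻¹gy ∈ T_s}` pointwise, and the split-torus identity -/

/-- PROVED — **`S_T` POINTWISE**: `#{y : y⁻¹gy ∈ T_s}` is `|G|` for scalar `g`, `2(q − 1)²` for split regular `g`, and `0` otherwise. [folklore] -/
theorem card_conj_mem_splitTorus (g : G q) :
    (Finset.univ.filter fun y : G q => y⁻¹ * g * y ∈ splitTorus q).card =
      if IsScalarMat (g : Mat q) then Fintype.card (G q)
      else if HasRatEigenvalue (g : Mat q) ∧ (g : Mat q).trace ^ 2 - 4 * (g : Mat q).det ≠ 0 then 2 * (q - 1) ^ 2 else 0 := by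
  split_ifs with hs hr
  · exact card_conj_mem_of_isScalar _ g hs (mem_splitTorus_of_isScalar hs)
  · rw [card_conj_mem, card_centralizer_of_split g hr.1 hr.2, card_splitTorus_conj_of_split g hr.1 hr.2]; ring
  · rw [card_conj_mem, card_splitTorus_conj_of_not g hs hr, mul_zero]

/-- PROVED — **THE SPLIT-TORUS IDENTITY**: for a class function `F`,
`|G|·Σ_{x ∈ T_s} F(x) = |G|·Σ_{g scalar} F(g) + 2(q − 1)²·Σ_{g split regular} F(g)`. [folklore] -/
theorem splitTorus_identity (F : G q → ℤ) (hcl : ∀ a b, F (a * b) = F (b * a)) :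
    (Fintype.card (G q) : ℤ) * ∑ x ∈ splitTorus q, F x =
      (Fintype.card (G q) : ℤ) * ∑ g ∈ Finset.univ.filter (fun g : G q => IsScalarMat (g : Mat q)), F g +
        2 * ((q : ℤ) - 1) ^ 2 * ∑ g ∈ Finset.univ.filter (fun g : G q =>
          HasRatEigenvalue (g : Mat q) ∧ (g : Mat q).trace ^ 2 - 4 * (g : Mat q).det ≠ 0), F g := by
  have hq1 : ((q - 1 : ℕ) : ℤ) = (q : ℤ) - 1 := by
    rw [Nat.cast_sub (Fact.out : q.Prime).one_le]; simp
  rw [← sum_mul_card_conj_mem (splitTorus q) F hcl, Finset.sum_filter, Finset.sum_filter, Finset.mul_sum, Finset.mul_sum,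
    ← Finset.sum_add_distrib]
  refine Finset.sum_congr rfl (fun g _ => ?_)
  rw [card_conj_mem_splitTorus g]
  by_cases hs : IsScalarMat (g : Mat q)
  · have hns : ¬ (HasRatEigenvalue (g : Mat q) ∧ (g : Mat q).trace ^ 2 - 4 * (g : Mat q).det ≠ 0) :=
      fun h => h.2 (PS.discr_eq_zero_of_isScalar hs)
    rw [if_pos hs, if_pos hs, if_neg hns, mul_zero, add_zero, mul_comm]
  · by_cases hr : HasRatEigenvalue (g : Mat q) ∧ (g : Mat q).trace ^ 2 - 4 * (g : Mat q).det ≠ 0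
    · rw [if_neg hs, if_neg hs, if_pos hr, if_pos hr, mul_zero, zero_add, Nat.cast_mul, Nat.cast_pow, hq1, Nat.cast_ofNat, mul_comm]
    · rw [if_neg hs, if_neg hs, if_neg hr, if_neg hr, Nat.cast_zero, mul_zero, mul_zero, mul_zero, add_zero]

/-- PROVED — **THE SPLIT REGULAR COUNT**: `2(q − 1)²·#{split regular} = |G|·((q − 1)² − (q − 1))`. [folklore] -/
theorem count_split :
    2 * ((q : ℤ) - 1) ^ 2 * ((Finset.univ.filter fun g : G q =>
        HasRatEigenvalue (g : Mat q) ∧ (g : Mat q).trace ^ 2 - 4 * (g : Mat q).det ≠ 0).card : ℤ) =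
      (Fintype.card (G q) : ℤ) * (((q : ℤ) - 1) ^ 2 - ((q : ℤ) - 1)) := by
  have hq1 : ((q - 1 : ℕ) : ℤ) = (q : ℤ) - 1 := by
    rw [Nat.cast_sub (Fact.out : q.Prime).one_le]; simp
  have h := splitTorus_identity (q := q) (fun _ => 1) (fun _ _ => rfl)
  simp only [Finset.sum_const, nsmul_eq_mul, mul_one, splitTorus_card, card_scalar, Nat.cast_pow, hq1] at h
  linear_combination -h

end Summit.BirchSwinnertonDyer.BirchSwinnertonDyer.Theorems.CartanSupply.NormOne

end
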